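/-
Copyright: the b2b-balaban cell (near-miss cell 7), T⁴-continuum fan-out, lineage t4-ne7b-p2 (node U5c RENEWAL member).
Released under the licence of the surrounding project.
-/
import Literature.MathematicalPhysics.QuantumFieldTheory.Balaban1983to89.T4EntropyShapeInstances

/-!
# The renewal route's catalogue on the tree's shapes: the root mass (births) and the renewal edge

Summits-side support leaf of the T⁴-continuum cell (rung (B)+1 on a FINITE torus only; NOT infinite volume, NOT the
mass gap, NOT the Clay statement; NOT a proof of the spine estimate NE7b).  Lineage `t4-ne7b-p2` (generation 22),
node U5c, RENEWAL route; leaves N3a (root mass) and N3b (renewal edges) of the ROUND-2 skeleton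
`t4/skeletons/NE7b-t4-ne7b-p2.md`, on the cell's [K] shape theorems `T4EntropyShapeInstances.birthResidualSum_le` ∕
`birthShapeSum_le` (the index model of the operation S, `B16SProfile`; DIVERGENCE D-b02g9.1).  [folklore] real arithmetic
over those theorems BY NAME; nothing printed is quoted or asserted; the per-cube ∕ per-event factors and the window enter
as DISPLAYED symbols (`a₂` = the birth credit per unit of `d′ + 1`, `P` = the flat part of the birth exponent, `p` = the
renewal factor's exponent, `κ₁·R` = the tilt raised to the own window, `cP` = the part of the credit the pairing spends —
their printed shapes (1.79) p. 383, p. 386 ll. 1–3 and the pairing `T4PersistentHistoryCount.credit_dominates_window_poly`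
are the instantiating seat's, cf. skeleton S1∕S4); no `def … : Prop` fact, no `[cite:]` tag of ours (the one cite tag in
this file's imports belongs to `birthShapeSum_le`'s location sentence).

WHAT.  §1 `rootMass_le` (N3a): at a slot (birth step `j`, anchor cube `c` in a window `B` of creation-scale cubes) the
ROOTS of the renewal forest are the face-connected birth shapes `X ∋ c`; with the bank-inflated root price
`pr X = exp(−(a₂·(d′(X) + 1)) − P)·exp(2μ·d′(X))` (the (1.79)-type birth factor with the doubled size bank `2μ·d′` of
skeleton N2 added back) and the own booking `z₁^{W} = exp(κ₁·R)` paired by `κ₁·R ≤ cP ≤ P`, the root pairing mass is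
`Σ_X pr X·exp(κ₁ R) ≤ exp(−(a₂ − 2μ))·K₀(d) ≤ K₀(d)` as soon as `a₂ − 2μ ≥ κ₀(d)` — a `B₀` depending on the dimension
only (`hpair₀` of `RenewalGroveSum.forestDom_of_grove_sum`).  §2 `renewalEdge_le` (N3b): a RENEWAL edge has ONE child per
parent and age (print: the renewed domain is `S(Z₀)`, deterministic; the new field's positions are inside the factor),
price `exp(−p)`, own booking `R`: `exp(−p)·exp(κ₁ R) ≤ exp(−(p − cP))` under the pairing `κ₁·R ≤ cP` — the `εr` of the
combined catalogue, small beyond the infrared threshold.  §3 decided toys.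

HONEST DEPENDENCY (cell): continuum YM on T⁴ ⇐ BetaPertH ∧ nine spine estimates (0/9 proved); BetaPertH ⇐ (D1) ∧ (D4)
∧ CAP+tail.  This file changes none of it.
-/

open Finset
open Literature.MathematicalPhysics.QuantumFieldTheory.Balaban1983to89
open Literature.MathematicalPhysics.QuantumFieldTheory.Balaban1983to89.B13ScaleTransfer
open Literature.MathematicalPhysics.QuantumFieldTheory.Balaban1983to89.TreeLength
open Literature.MathematicalPhysics.QuantumFieldTheory.Balaban1983to89.T4EntropyShapeInstances

namespace Summit.QuantumFields.BalabanUV.T4Continuum.RenewalRootMass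

noncomputable section

variable {d : ℕ}

/-! ## §1 The root pairing mass of a slot -/

section Roots

/-- **N3a — THE ROOT MASS IS DIMENSION-ONLY.**  Window `B` of creation-scale cubes, anchor `c ∈ B`; root price
`exp(−(a₂·(d′(X)+1)) − P)·exp(2μ·d′(X))` on the face-connected shapes `X ∋ c`; own booking `exp(κ₁·R)` with the pairing
`κ₁·R ≤ cP ≤ P`; rate condition `κ₀(d) ≤ a₂ − 2μ` ⇒
`Σ_X exp(−(a₂·(d′(X)+1)) − P)·exp(2μ·d′(X))·exp(κ₁·R) ≤ exp(−(a₂ − 2μ))·K₀(d)`.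
By `T4EntropyShapeInstances.birthResidualSum_le` at the rate `a₂ − 2μ`. [folklore] -/
theorem rootMass_le (B : Finset (Pt d)) {c : Pt d} (hc : c ∈ B) {a₂ μ P κ₁ R cP : ℝ}
    (hrate : shapeRate d ≤ a₂ - 2 * μ) (hμ : 0 ≤ μ) (hpair : κ₁ * R ≤ cP) (hcP : cP ≤ P)
    [DecidablePred fun X : Finset (Pt d) => c ∈ X ∧ FaceConnected X] :
    ∑ X ∈ B.powerset.filter (fun X => c ∈ X ∧ FaceConnected X),
        Real.exp (-(a₂ * (treeLen X + 1)) - P) * Real.exp (2 * μ * treeLen X) * Real.exp (κ₁ * R) ≤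
      Real.exp (-(a₂ - 2 * μ)) * shapeConst d := by
  -- each summand is at most the residual shape weight at rate `a₂ − 2μ`
  have h1 : ∀ X ∈ B.powerset.filter (fun X => c ∈ X ∧ FaceConnected X),
      Real.exp (-(a₂ * (treeLen X + 1)) - P) * Real.exp (2 * μ * treeLen X) * Real.exp (κ₁ * R) ≤
        Real.exp (-((a₂ - 2 * μ) * (treeLen X + 1))) := by
    intro X _
    rw [← Real.exp_add, ← Real.exp_add]
    refine Real.exp_le_exp.2 ?_
    have ht := treeLen_nonneg X
    nlinarith
  calc ∑ X ∈ B.powerset.filter (fun X => c ∈ X ∧ FaceConnected X),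
        Real.exp (-(a₂ * (treeLen X + 1)) - P) * Real.exp (2 * μ * treeLen X) * Real.exp (κ₁ * R)
      ≤ ∑ X ∈ B.powerset.filter (fun X => c ∈ X ∧ FaceConnected X), Real.exp (-((a₂ - 2 * μ) * (treeLen X + 1))) :=
        Finset.sum_le_sum h1
    _ ≤ Real.exp (-(a₂ - 2 * μ)) * shapeConst d := birthResidualSum_le B hc hrate

/-- **… SO `B₀ := K₀(d)` SERVES AT EVERY SLOT** (the exponential prefactor is `≤ 1` once `a₂ ≥ 2μ`, automatic under the
rate condition since `κ₀(d) ≥ 0`). [folklore] -/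
theorem rootMass_le_shapeConst (B : Finset (Pt d)) {c : Pt d} (hc : c ∈ B) {a₂ μ P κ₁ R cP : ℝ}
    (hrate : shapeRate d ≤ a₂ - 2 * μ) (hμ : 0 ≤ μ) (hpair : κ₁ * R ≤ cP) (hcP : cP ≤ P)
    [DecidablePred fun X : Finset (Pt d) => c ∈ X ∧ FaceConnected X] :
    ∑ X ∈ B.powerset.filter (fun X => c ∈ X ∧ FaceConnected X),
        Real.exp (-(a₂ * (treeLen X + 1)) - P) * Real.exp (2 * μ * treeLen X) * Real.exp (κ₁ * R) ≤ shapeConst d := by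
  refine (rootMass_le B hc hrate hμ hpair hcP).trans ?_
  have h0 : 0 ≤ a₂ - 2 * μ := (shapeRate_nonneg d).trans hrate
  have h1 : Real.exp (-(a₂ - 2 * μ)) ≤ 1 := Real.exp_le_one_iff.2 (by linarith)
  calc Real.exp (-(a₂ - 2 * μ)) * shapeConst d ≤ 1 * shapeConst d :=
        mul_le_mul_of_nonneg_right h1 (shapeConst_pos d).le
    _ = shapeConst d := one_mul _

end Roots

/-! ## §2 The renewal edge: one child, price `exp(−p)`, own booking `R` -/

section RenewalEdge

/-- **N3b — THE RENEWAL EDGE'S CATALOGUE MASS**: `exp(−p)·exp(κ₁·R) ≤ exp(−(p − cP))` under the pairing `κ₁·R ≤ cP`.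
(One child per parent and age: the renewed domain is the parent's S-image; nothing to count.) [folklore] -/
theorem renewalEdge_le {p κ₁ R cP : ℝ} (hpair : κ₁ * R ≤ cP) :
    Real.exp (-p) * Real.exp (κ₁ * R) ≤ Real.exp (-(p - cP)) := by
  rw [← Real.exp_add]
  exact Real.exp_le_exp.2 (by linarith)

/-- **… IS SMALL BEYOND THE INFRARED THRESHOLD**: if the pairing spends at most the fraction `θ < 1` of the credit,
`cP ≤ θ·p`, then the edge mass is `≤ exp(−(1 − θ)·p)`, which is `≤ ε` as soon as `log ε⁻¹ ≤ (1 − θ)·p`. [folklore] -/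
theorem renewalEdge_le_of_threshold {p κ₁ R cP θ ε : ℝ} (hpair : κ₁ * R ≤ cP) (hθ : cP ≤ θ * p) (hε : 0 < ε)
    (hthr : Real.log ε⁻¹ ≤ (1 - θ) * p) :
    Real.exp (-p) * Real.exp (κ₁ * R) ≤ ε := by
  refine (renewalEdge_le hpair).trans ?_
  have h1 : Real.exp (-(p - cP)) ≤ Real.exp (-((1 - θ) * p)) := Real.exp_le_exp.2 (by nlinarith)
  refine h1.trans ?_
  rw [← Real.log_le_log_iff (Real.exp_pos _) hε, Real.log_exp]
  have h2 : Real.log ε⁻¹ = -Real.log ε := Real.log_inv ε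
  linarith

end RenewalEdge

/-! ## §3 Decided toys -/

section Toy

/-- the renewal edge on numbers: `p = 8`, pairing spends `cP = 2` (`κ₁ = 1`, `R = 2`): mass `≤ e^{−6}` -/
example : Real.exp (-8) * Real.exp (1 * 2) ≤ Real.exp (-(8 - 2)) := renewalEdge_le (by norm_num)

/-- the exponents of the root bound on numbers: `a₂ = 10`, `μ = 2`, so the rate is `6` and the prefactor `e^{−6} ≤ 1`;
a shape of tree length `3` with `P = 5`, `κ₁ R = 4 ≤ cP = 4 ≤ 5` has exponent
`−(10·4) − 5 + 12 + 4 = −29 ≤ −(6·4) = −24`, decided -/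
example : (-(10 * ((3 : ℚ) + 1)) - 5) + 2 * 2 * 3 + 4 ≤ -((10 - 2 * 2) * (3 + 1)) := by norm_num

end Toy

end

end Summit.QuantumFields.BalabanUV.T4Continuum.RenewalRootMass
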